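import Literature.Geometry.Symplectic.AlmostComplexChernNumberLocalization
import Literature.Geometry.Symplectic.ComplexOrientationExists
import Literature.AlgebraicTopology.CharacteristicClasses.CompletionThomClassIndexDegree
import Literature.AlgebraicTopology.SingularHomology.OrientationReversingHomeomorph
import HarnessLib

/-!
# The index of a non-degenerate zero of a vector field on an almost complex `4`-manifold is the sign
# of its Jacobian, for the orientation induced by `J` (up to a universal unit)

D. McDuff, D. Salamon, *Introduction to Symplectic Topology*, 3rd ed. (2017), Ex. 4.4.3 (v) with
Rem. 2.7.2 / Thm. 2.7.5 (the top Chern number `⟨c₂(TX), [X]⟩` of an almost complex `4`-manifold is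
computed from the zeros of a vector field, each counted with the sign of its Jacobian for the
orientation induced by `J`) and §4.1 ("Every almost complex manifold is oriented");
J. Milnor, J. Stasheff, *Characteristic Classes* (1974), §12 (the index of a vector field) and
Appendix A (local degree = sign of the Jacobian); M. Hirsch, *Differential Topology* (1976), Ch. 4 §4.

For a `C^∞` almost complex structure `J` on a `4`-manifold `N`, a `J`-positive smooth volume form `v`
(`ComplexOrientationExists`), the smooth orientation `o = o(J, v)` it defines
(`smoothOrientationOfPositiveTopForm`, at `p`: `[e₀,…,e₃]` iff `v_p(e₀,…,e₃) > 0`) and the attached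
homological `ℤ`-orientation `μ_o = homologicalOrientationOfSmooth o`, the local index
`ind_p(Y) = vectorFieldIndex` (`AlmostComplexChernNumberLocalization`: the local index of the section
`β(Y)` of `(TN, J)`) of a continuous vector field `Y` at a non-degenerate zero `p` is, by the rank-`k`
degree theorem `localIndex_eq_sign_det_mul_indexUnitK` (`CompletionThomClassIndexDegree`),
`sign det(Λ_p ∘ L_p) · κ(L_f, μR o p)`, where `L_p` is the derivative of the chart representative of
`Y`, `Λ_p = L_f⁻¹ ∘ β_p : ℝ⁴ ≅ ℝ⁴` the FRAME MAP of a fixed real frame `L_f : ℝ⁴ ≅ ℂ²` of the model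
fibre, and `μR o p` the oriented reference orientation.  This file proves that the two
chart-dependent signs cancel, exactly as in the surface case (`SurfaceTangentIndexSign`):

* `indexUnitK_μR` — `κ(L, μR o p) = ±κ(L, μE)` according as the preferred chart at `p` is positively
  oriented (the reflection reverses the reference orientation, `comap_localClass_eq_neg_of_hasFDerivAt`);
* `frameStructure`, `frameSign`, `det_frameMap_pos_iff` — `Λ_p` intertwines `J_p` with the
  complex structure `J₀ = L_f⁻¹ i L_f` of `ℝ⁴`, so it maps `J_p`-adapted frames to `J₀`-adapted frames,
  all of which have one orientation (`ComplexStructure.orientation_eq_of_isAdaptedBasis`); hence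
  `0 < det Λ_p ↔ (v_p(e₀,…,e₃) > 0 ↔ [e₀,…,e₃] = or(J₀))`, the right-hand statement — that
  `J₀`-adapted frames are positively oriented, sign `ε(L_f) = frameSign L_f = ±1` — depending on the
  fixed frame `L_f` alone (neither on the chart nor on the point);
* **`vectorFieldIndex_eq_sign_det`** — consequently, at a zero `p` of `Y` whose chart representative
  has invertible derivative `L_p`,

    `ind_p(Y) = ε(L_f) · sign(det L_p) · κ(L_f, μE 4)`,   `ε(L_f) = ±1`, `κ = ±1`,

  with the unit `ε(L_f) κ(L_f, μE 4)` INDEPENDENT of `N`, `J`, `v`, `Y` and `p`.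

Everything is proved; no named facts.  (Sequel: summing over the zeros of the gradient of a Morse
function gives `⟨c₂(TN, J), [N]_{μ_o}⟩ = ±χ(N)` with a universal sign.)

## References

* [McDuffSalamon2017] D. McDuff, D. Salamon, Introduction to Symplectic Topology, 3rd ed., OUP 2017,
  §4.1, Rem. 2.7.2, Thm. 2.7.5, Ex. 4.4.3 (v).
* [MilnorStasheff1974] J. Milnor, J. Stasheff, Characteristic Classes, PUP 1974, §12, Appendix A.
* [HirschDT1976] M. W. Hirsch, Differential Topology, GTM 33, Springer 1976, Ch. 4 §4.
-/

noncomputable section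

open scoped Manifold ContDiff Topology
open Set Function Filter Module Bundle
open Literature.AlgebraicTopology.SingularHomology Literature.AlgebraicTopology.CharacteristicClasses
open Literature.Topology.FourManifolds Literature.Topology.FourManifolds.HomologicalOrientationOfSmooth

namespace Literature.Geometry.Symplectic

/-! ### The index unit of the reference orientations `μR o p` (any dimension) -/

section IndexUnit

variable {n : ℕ} (F : Type) [NormedAddCommGroup F] [NormedSpace ℂ F] [FiniteDimensional ℂ F]
  {k : ℕ} (hF : finrank ℂ F = k) (hk : 1 ≤ k) (hn : 2 * k = n) (L : EuclideanSpace ℝ (Fin n) ≃L[ℝ] F)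

/-- `((μE n).comap refl)_0 = (μE n)_0`. [folklore] -/
theorem comap_refl_μE_localClass_dim (n : ℕ) :
    ((μE n).comap (Homeomorph.refl (EuclideanSpace ℝ (Fin n)))).localClass 0 = (μE n).localClass 0 := by
  rw [pres_iff_comap_eq.1 (pres_refl (μE n))]

/-- **The reflection reverses the reference orientation of `ℝⁿ` at the origin** (`n ≥ 1`):
`((μE n).comap r)_0 = -(μE n)_0` (its Jacobian `r` has determinant `-1`; the tree's fixed-point
criterion `comap_localClass_eq_neg_of_hasFDerivAt`). [cite: HirschDT1976, Ch. 4 §4 pp. 105–106] -/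
theorem comap_reflHomeo_μE_localClass_dim (hn0 : 0 < n) :
    ((μE n).comap (reflHomeo (n := n))).localClass 0 = -(μE n).localClass 0 := by
  have hdet : LinearMap.det ((reflE (n := n) : EuclideanSpace ℝ (Fin n) →L[ℝ] EuclideanSpace ℝ (Fin n)) :
      EuclideanSpace ℝ (Fin n) →ₗ[ℝ] EuclideanSpace ℝ (Fin n)) < 0 := by
    have h : LinearMap.det ((reflE (n := n) : EuclideanSpace ℝ (Fin n) →L[ℝ] EuclideanSpace ℝ (Fin n)) :
        EuclideanSpace ℝ (Fin n) →ₗ[ℝ] EuclideanSpace ℝ (Fin n)) = -1 := det_reflE (n := n) hn0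
    rw [h]
    norm_num
  have hA : HasFDerivAt (fun v : EuclideanSpace ℝ (Fin n) ↦ (OpenPartialHomeomorph.refl (EuclideanSpace ℝ (Fin n)))
      (reflHomeo (n := n) ((OpenPartialHomeomorph.refl (EuclideanSpace ℝ (Fin n))).symm v))) (reflE (n := n))
      ((OpenPartialHomeomorph.refl (EuclideanSpace ℝ (Fin n))) 0) :=
    (reflE (n := n)).hasFDerivAt
  exact (μE n).comap_localClass_eq_neg_of_hasFDerivAt (reflHomeo (n := n)) (by simp)
    (OpenPartialHomeomorph.refl (EuclideanSpace ℝ (Fin n))) (mem_univ _) hA hdet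

variable {X : Type*} [TopologicalSpace X] [ChartedSpace (EuclideanSpace ℝ (Fin n)) X] [IsManifold (𝓡 n) 1 X]

include hn hk in
omit [FiniteDimensional ℂ F] in
/-- `n ≥ 1` when `n = 2k`, `k ≥ 1`. [folklore] -/
theorem dim_pos_of_rank : 0 < n := by omega

open Classical in
/-- **The index unit of the oriented reference orientation at `p`**: `κ(L, μR o p) = ±κ(L, μE)`
according as the preferred chart at `p` is positively oriented or not. [folklore] -/
theorem indexUnitK_μR (o : SmoothOrientation (𝓡 n) X) (p : X) :
    indexUnitK F hF hk hn L (μR o p) =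
      if o p = euclideanOrientation n then indexUnitK F hF hk hn L (μE n) else -indexUnitK F hF hk hn L (μE n) := by
  unfold μR Rh
  split_ifs with h
  · exact indexUnitK_eq_of_localClass_eq F hF hk hn L (comap_refl_μE_localClass_dim n)
  · exact indexUnitK_eq_neg_of_localClass_eq_neg F hF hk hn L
      (comap_reflHomeo_μE_localClass_dim (dim_pos_of_rank hk hn))

/-- **Sign coherence**: if `0 < dΛ ↔ (o p = [e₀, …] ↔ P)` then
`sign(dΛ · dL) · κ(L, μR o p) = ε(P) · sign(dL) · κ(L, μE)`, `ε(P) = ±1`. [folklore] -/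
theorem sign_mul_indexUnitK_μR (o : SmoothOrientation (𝓡 n) X) (p : X) {dΛ dL : ℝ} {P : Prop} [Decidable P]
    (hΛ : 0 < dΛ ↔ (o p = euclideanOrientation n ↔ P)) (hΛ0 : dΛ ≠ 0) (hL0 : dL ≠ 0) :
    (if 0 < dΛ * dL then 1 else -1) * indexUnitK F hF hk hn L (μR o p) =
      (if P then 1 else -1) * ((if 0 < dL then 1 else -1) * indexUnitK F hF hk hn L (μE n)) := by
  rw [indexUnitK_μR]
  rcases lt_or_gt_of_ne hΛ0 with hneg | hpos
  · have hno : ¬(o p = euclideanOrientation n ↔ P) := fun h ↦ (lt_asymm hneg) (hΛ.2 h)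
    rcases lt_or_gt_of_ne hL0 with hLn | hLp
    · rw [if_pos (mul_pos_of_neg_of_neg hneg hLn), if_neg (not_lt.2 hLn.le)]
      by_cases hP : P
      · rw [if_neg (fun h ↦ hno (iff_of_true h hP)), if_pos hP]; ring
      · rw [if_pos (by_contra fun h ↦ hno (iff_of_false h hP)), if_neg hP]; ring
    · rw [if_neg (not_lt.2 (mul_neg_of_neg_of_pos hneg hLp).le), if_pos hLp]
      by_cases hP : P
      · rw [if_neg (fun h ↦ hno (iff_of_true h hP)), if_pos hP]; ring
      · rw [if_pos (by_contra fun h ↦ hno (iff_of_false h hP)), if_neg hP]; ring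
  · have ho : (o p = euclideanOrientation n ↔ P) := hΛ.1 hpos
    rcases lt_or_gt_of_ne hL0 with hLn | hLp
    · rw [if_neg (not_lt.2 (mul_neg_of_pos_of_neg hpos hLn).le), if_neg (not_lt.2 hLn.le)]
      by_cases hP : P
      · rw [if_pos (ho.2 hP), if_pos hP]; ring
      · rw [if_neg (fun h ↦ hP (ho.1 h)), if_neg hP]; ring
    · rw [if_pos (mul_pos hpos hLp), if_pos hLp]
      by_cases hP : P
      · rw [if_pos (ho.2 hP), if_pos hP]; ring
      · rw [if_neg (fun h ↦ hP (ho.1 h)), if_neg hP]; ring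

end IndexUnit

/-! ### The frame map of `(TN, J)` in dimension four and its orientation behaviour -/

section Frame

variable {N : Type} [TopologicalSpace N] [ChartedSpace (EuclideanSpace ℝ (Fin 4)) N] [IsManifold (𝓡 4) ∞ N]
  (J : AlmostComplexStructure (𝓡 4) ∞ N)
  (Lf : EuclideanSpace ℝ (Fin 4) ≃L[ℝ] (Fin (finrank ℝ (EuclideanSpace ℝ (Fin 4)) / 2) → ℂ))

/-- **The frame map `Λ_p = L_f⁻¹ ∘ β_p : ℝ⁴ ≅ ℝ⁴` at `p`**: tangent space (read in the chart) → model
fibre `ℂ²` of `(TN, J)` (`β_p = J.modelIsoAt p`) → `ℝ⁴` by the fixed real frame `L_f` — the linear part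
of the local representative of the section of `(TN, J)` attached to a vector field.
[cite: McDuffSalamon2017, Thm. 2.7.5 and Ex. 4.4.3 (v)] -/
def frameMap (p : N) : EuclideanSpace ℝ (Fin 4) ≃L[ℝ] EuclideanSpace ℝ (Fin 4) := (J.modelIsoAt p).trans Lf.symm

/-- `Λ_p v = L_f⁻¹ (β_p v)`. [folklore] -/
theorem frameMap_apply (p : N) (v : EuclideanSpace ℝ (Fin 4)) : frameMap J Lf p v = Lf.symm (J.modelIsoAt p v) := rfl

variable {J} in
/-- **The model complex structure `J₀ = L_f⁻¹ i L_f` of `ℝ⁴`** attached to the frame. [folklore] -/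
def frameStructure : ComplexStructure (EuclideanSpace ℝ (Fin 4)) where
  J := (Lf.symm.toLinearEquiv : (Fin (finrank ℝ (EuclideanSpace ℝ (Fin 4)) / 2) → ℂ) →ₗ[ℝ] EuclideanSpace ℝ (Fin 4)) ∘ₗ
    ((Complex.I • LinearMap.id : (Fin (finrank ℝ (EuclideanSpace ℝ (Fin 4)) / 2) → ℂ) →ₗ[ℂ] _).restrictScalars ℝ) ∘ₗ
      (Lf.toLinearEquiv : EuclideanSpace ℝ (Fin 4) →ₗ[ℝ] (Fin (finrank ℝ (EuclideanSpace ℝ (Fin 4)) / 2) → ℂ))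
  J_sq v := by
    simp only [LinearMap.comp_apply, LinearMap.restrictScalars_apply, LinearMap.smul_apply, LinearMap.id_apply,
      LinearEquiv.coe_coe, ContinuousLinearEquiv.coe_toLinearEquiv, ContinuousLinearEquiv.apply_symm_apply,
      smul_smul, Complex.I_mul_I, neg_smul, one_smul, map_neg, ContinuousLinearEquiv.symm_apply_apply]

/-- `J₀ w = L_f⁻¹ (i · L_f w)`. [folklore] -/
theorem frameStructure_J_apply (w : EuclideanSpace ℝ (Fin 4)) :
    (frameStructure Lf).J w = Lf.symm (Complex.I • Lf w) := rfl

/-- **`Λ_p` is complex-linear for `J_p` and `J₀`**: `Λ_p (J_p v) = J₀ (Λ_p v)` (`β_p J_p = i β_p`).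
[cite: McDuffSalamon2017, §2.6] -/
theorem frameMap_apply_J (p : N) (v : EuclideanSpace ℝ (Fin 4)) :
    frameMap J Lf p (J p v) = (frameStructure Lf).J (frameMap J Lf p v) := by
  rw [frameMap_apply, frameMap_apply, frameStructure_J_apply, ContinuousLinearEquiv.apply_symm_apply,
    show J p v = J.Jm p v from rfl, AlmostComplexStructure.modelIsoAt_apply_Jm]

/-- `J₀ = Λ_p J_p Λ_p⁻¹`: the frame structure is the conjugate of `J_p` by `Λ_p`. [folklore] -/
theorem conj_complexStructureAt_frameMap (p : N) :
    (J.complexStructureAt p).conj (frameMap J Lf p).toLinearEquiv = frameStructure Lf := by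
  apply ComplexStructure.ext'
  refine LinearMap.ext fun w ↦ ?_
  rw [ComplexStructure.conj_J_apply, AlmostComplexStructure.complexStructureAt_J_apply]
  change frameMap J Lf p (J p ((frameMap J Lf p).symm w)) = _
  rw [frameMap_apply_J, ContinuousLinearEquiv.apply_symm_apply]

/-- The standard basis of `ℝ⁴`. [folklore] -/
abbrev stdBasisFour : Basis (Fin 4) ℝ (EuclideanSpace ℝ (Fin 4)) := (EuclideanSpace.basisFun (Fin 4) ℝ).toBasis

/-- Every `J₀`-adapted basis has the complex orientation of `J₀`; in the usable form: the standard
basis is oriented like the complex orientation of `J₀` iff it is oriented like any given adapted basis. [folklore] -/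
theorem orientation_eq_frameStructure_iff_of_isAdaptedBasis {b : Basis (Fin 4) ℝ (EuclideanSpace ℝ (Fin 4))}
    (hb : ComplexStructure.IsAdaptedBasis (frameStructure Lf).J b) :
    stdBasisFour.orientation = (frameStructure Lf).orientation finrank_euclideanSpace_fin ↔
      stdBasisFour.orientation = b.orientation := by
  rw [(frameStructure Lf).orientation_eq_of_isAdapted finrank_euclideanSpace_fin hb]

open Classical in
/-- **The frame sign `ε(L_f) = ±1`**: `+1` iff the `J₀`-adapted frames `(w, J₀ w, w', J₀ w')` of `ℝ⁴` are
positively oriented, i.e. iff the standard orientation of `ℝ⁴` is the complex orientation of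
`J₀ = L_f⁻¹ i L_f` (a property of the fixed frame `L_f` alone). [folklore] -/
def frameSign : ℤ :=
  if stdBasisFour.orientation = (frameStructure Lf).orientation finrank_euclideanSpace_fin then 1 else -1

/-- `ε(L_f) = ±1`. [folklore] -/
theorem frameSign_eq_one_or_eq_neg_one : frameSign Lf = 1 ∨ frameSign Lf = -1 := by
  unfold frameSign
  split_ifs
  · exact Or.inl rfl
  · exact Or.inr rfl

/-- **Orientation behaviour of the frame map**: for a `J`-positive `4`-form `v`,
`0 < det Λ_p ↔ (v_p(e₀, …, e₃) > 0 ↔ [e₀, …, e₃] = or(J₀))`.  Take a `J_p`-adapted basis `B`: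
`v_p(e) = v_p(B) · det_B(e)` with `v_p(B) > 0`; `det Λ_p · det_e(B) = det_e(Λ_p B)` and `Λ_p B` is
`J₀`-adapted. [cite: McDuffSalamon2017, §4.1] -/
theorem det_frameMap_pos_iff {v : Literature.Geometry.Kaehler.MForm (𝓡 4) N ℝ 4} (hJv : J.IsPositiveTopForm v) (p : N) :
    0 < LinearMap.det ((frameMap J Lf p : EuclideanSpace ℝ (Fin 4) →L[ℝ] EuclideanSpace ℝ (Fin 4)) :
        EuclideanSpace ℝ (Fin 4) →ₗ[ℝ] EuclideanSpace ℝ (Fin 4)) ↔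
      (0 < AlmostComplexStructure.coeffFour (v p) ↔
        stdBasisFour.orientation = (frameStructure Lf).orientation finrank_euclideanSpace_fin) := by
  set Λ := frameMap J Lf p with hΛ
  set e : Basis (Fin 4) ℝ (EuclideanSpace ℝ (Fin 4)) := stdBasisFour with he
  obtain ⟨B, hB⟩ := (J.complexStructureAt p).exists_isAdaptedBasis (AlmostComplexStructure.finrank_tangentSpace_four p)
  -- (1) `v_p(B) = v_p(e) · e.det B`, `v_p(B) > 0`
  have hvB : 0 < v p B := hJv p B hB
  have hve : v p B = AlmostComplexStructure.coeffFour (v p) * e.det B := by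
    have h1 := (v p).toAlternatingMap.eq_smul_basis_det e
    have h2 := congrArg (fun f : (EuclideanSpace ℝ (Fin 4)) [⋀^Fin 4]→ₗ[ℝ] ℝ ↦ f B) h1
    simp only [AlternatingMap.smul_apply, smul_eq_mul] at h2
    rw [AlmostComplexStructure.coeffFour, show (⇑(EuclideanSpace.basisFun (Fin 4) ℝ) : Fin 4 → EuclideanSpace ℝ (Fin 4)) = ⇑e by
      rw [he, OrthonormalBasis.coe_toBasis]]
    exact h2
  have hc : 0 < AlmostComplexStructure.coeffFour (v p) ↔ 0 < e.det B := by
    rw [hve] at hvB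
    rcases pos_and_pos_or_neg_and_neg_of_mul_pos hvB with ⟨h1, h2⟩ | ⟨h1, h2⟩
    · exact iff_of_true h1 h2
    · exact iff_of_false (not_lt.2 h1.le) (not_lt.2 h2.le)
  -- (2) `det Λ · e.det B = e.det (Λ B)` and `Λ B` is `J₀`-adapted
  have hdet : e.det (⇑(B.map (Λ : EuclideanSpace ℝ (Fin 4) ≃L[ℝ] EuclideanSpace ℝ (Fin 4)).toLinearEquiv)) =
      LinearMap.det ((Λ : EuclideanSpace ℝ (Fin 4) →L[ℝ] EuclideanSpace ℝ (Fin 4)) :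
        EuclideanSpace ℝ (Fin 4) →ₗ[ℝ] EuclideanSpace ℝ (Fin 4)) * e.det B := by
    rw [show (⇑(B.map (Λ : EuclideanSpace ℝ (Fin 4) ≃L[ℝ] EuclideanSpace ℝ (Fin 4)).toLinearEquiv) : Fin 4 → _) =
      (⇑((Λ : EuclideanSpace ℝ (Fin 4) →L[ℝ] EuclideanSpace ℝ (Fin 4)) :
        EuclideanSpace ℝ (Fin 4) →ₗ[ℝ] EuclideanSpace ℝ (Fin 4))) ∘ ⇑B from
        funext fun i ↦ by rw [Function.comp_apply, Module.Basis.map_apply]; rfl, Module.Basis.det_comp]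
  have hBΛ : ComplexStructure.IsAdaptedBasis (frameStructure Lf).J
      (B.map (Λ : EuclideanSpace ℝ (Fin 4) ≃L[ℝ] EuclideanSpace ℝ (Fin 4)).toLinearEquiv) := by
    rw [← conj_complexStructureAt_frameMap J Lf p]
    exact (J.complexStructureAt p).isAdaptedBasis_map hB _
  -- (3) orientations: `0 < e.det X ↔ e.orientation = X.orientation`
  have h3 : 0 < e.det (⇑(B.map (Λ : EuclideanSpace ℝ (Fin 4) ≃L[ℝ] EuclideanSpace ℝ (Fin 4)).toLinearEquiv)) ↔
      stdBasisFour.orientation = (frameStructure Lf).orientation finrank_euclideanSpace_fin := by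
    rw [orientation_eq_frameStructure_iff_of_isAdaptedBasis Lf hBΛ, ← Basis.orientation_eq_iff_det_pos]
  have hne : e.det B ≠ 0 := (e.isUnit_det B).ne_zero
  -- assemble
  rw [hc, ← h3, hdet]
  rcases lt_or_gt_of_ne hne with hn | hp
  · constructor
    · intro h
      exact iff_of_false (not_lt.2 hn.le) (not_lt.2 (mul_neg_of_pos_of_neg h hn).le)
    · intro h
      by_contra hΛn
      have hΛn' : LinearMap.det ((Λ : EuclideanSpace ℝ (Fin 4) →L[ℝ] EuclideanSpace ℝ (Fin 4)) :
          EuclideanSpace ℝ (Fin 4) →ₗ[ℝ] EuclideanSpace ℝ (Fin 4)) < 0 :=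
        lt_of_le_of_ne (not_lt.1 hΛn) (Λ.toLinearEquiv.isUnit_det'.ne_zero ∘ fun h ↦ by exact h)
      exact (not_lt.2 hn.le) (h.2 (mul_pos_of_neg_of_neg hΛn' hn))
  · constructor
    · intro h
      exact iff_of_true hp (mul_pos h hp)
    · intro h
      exact pos_of_mul_pos_left (α := ℝ) ((h.1 hp)) hp.le

variable {J} in
/-- The smooth orientation of a `J`-positive form reads `[e₀, …, e₃]` at `p` iff `v_p(e₀, …, e₃) > 0`. [folklore] -/
theorem smoothOrientationOfPositiveTopForm_eq_iff {v : Literature.Geometry.Kaehler.MForm (𝓡 4) N ℝ 4}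
    (hv : Literature.Geometry.Kaehler.IsSmoothForm v) (hJv : J.IsPositiveTopForm v) (p : N) :
    J.smoothOrientationOfPositiveTopForm v hv hJv p = euclideanOrientation 4 ↔ 0 < AlmostComplexStructure.coeffFour (v p) := by
  rw [AlmostComplexStructure.smoothOrientationOfPositiveTopForm_apply]
  unfold signOrientationIn
  split_ifs with h
  · exact iff_of_true rfl h
  · exact iff_of_false (Module.Ray.ne_neg_self _).symm h

/-- **Orientation coherence of the frame maps**: for the smooth orientation `o` of a `J`-positive
form, `0 < det Λ_p ↔ (o p = [e₀, …, e₃] ↔ [e₀, …, e₃] = or(J₀))` at EVERY point `p`. [cite: McDuffSalamon2017, §4.1] -/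
theorem det_frameMap_pos_iff_orientation {v : Literature.Geometry.Kaehler.MForm (𝓡 4) N ℝ 4}
    (hv : Literature.Geometry.Kaehler.IsSmoothForm v) (hJv : J.IsPositiveTopForm v) (p : N) :
    0 < LinearMap.det ((frameMap J Lf p : EuclideanSpace ℝ (Fin 4) →L[ℝ] EuclideanSpace ℝ (Fin 4)) :
        EuclideanSpace ℝ (Fin 4) →ₗ[ℝ] EuclideanSpace ℝ (Fin 4)) ↔
      (J.smoothOrientationOfPositiveTopForm v hv hJv p = euclideanOrientation 4 ↔
        stdBasisFour.orientation = (frameStructure Lf).orientation finrank_euclideanSpace_fin) := by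
  rw [det_frameMap_pos_iff J Lf hJv p, smoothOrientationOfPositiveTopForm_eq_iff hv hJv p]

end Frame

/-! ### The local index of the section of `(TN, J)` attached to a vector field -/

section LocalIndex

variable {N : Type} [TopologicalSpace N] [T2Space N] [CompactSpace N] [ChartedSpace (EuclideanSpace ℝ (Fin 4)) N]
  [IsManifold (𝓡 4) ∞ N] (J : AlmostComplexStructure (𝓡 4) ∞ N)
  (Lf : EuclideanSpace ℝ (Fin 4) ≃L[ℝ] (Fin (finrank ℝ (EuclideanSpace ℝ (Fin 4)) / 2) → ℂ))

/-- `0 < dim ℝ⁴ / 2`. [folklore] -/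
theorem half_dim_four_pos : 0 < finrank ℝ (EuclideanSpace ℝ (Fin 4)) / 2 := by
  rw [AlmostComplexStructure.finrank_euclideanSpace_four_div_two]; exact two_pos

/-- `2 · (dim ℝ⁴ / 2) = 4`. [folklore] -/
theorem two_mul_half_dim_four : 2 * (finrank ℝ (EuclideanSpace ℝ (Fin 4)) / 2) = 4 := by
  rw [AlmostComplexStructure.finrank_euclideanSpace_four_div_two]

/-- **The index unit of `(TN, J)` in dimension four** for the frame `L_f` and an orientation `g` of `ℝ⁴`:
`κ(L_f, g)` of `CompletionThomClassIndexUnit` for the model fibre `ℂ²` of the complex tangent bundle. [folklore] -/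
abbrev indexUnitFour (g : HomologicalOrientation ℤ (EuclideanSpace ℝ (Fin 4)) 4) : ℤ :=
  indexUnitK J.complexTangentBundle.F rfl (J.rank_complexTangentBundle_pos half_dim_four_pos)
    (J.two_mul_rank_complexTangentBundle two_mul_half_dim_four) Lf g

omit [T2Space N] [CompactSpace N] in
/-- `κ = ±1`. [folklore] -/
theorem indexUnitFour_eq_one_or_eq_neg_one (g : HomologicalOrientation ℤ (EuclideanSpace ℝ (Fin 4)) 4) :
    indexUnitFour J Lf g = 1 ∨ indexUnitFour J Lf g = -1 :=
  indexUnitK_eq_one_or_eq_neg_one _ _ _ _ _ _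

open Classical in
/-- **The local index of `β(Y)` at a non-degenerate zero of the vector field `Y`, for the orientation
induced by `J`**: with `o` the smooth orientation of a `J`-positive smooth `4`-form `v` and `μ_o` its
homological orientation,

  `ind_p(Y) = ε(L_f) · sign(det L_p) · κ(L_f, μE 4)`,

`L_p` the derivative at `φ p` of the chart representative of `Y`; the unit `ε(L_f) κ(L_f, μE 4) = ±1`
does not depend on `N`, `J`, `v`, `Y`, `p` (McDuff–Salamon Ex. 4.4.3 (v) / Thm. 2.7.5: the zeros of a
transverse section count with the sign of the Jacobian for the complex orientation).
[cite: McDuffSalamon2017, Thm. 2.7.5 and Ex. 4.4.3 (v)] [cite: MilnorStasheff1974, §12 and Appendix A] -/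
theorem vectorFieldIndex_eq_sign_det {v : Literature.Geometry.Kaehler.MForm (𝓡 4) N ℝ 4}
    (hv : Literature.Geometry.Kaehler.IsSmoothForm v) (hJv : J.IsPositiveTopForm v)
    {Y : Π x : N, TangentSpace (𝓡 4) x} (hY : Continuous fun x ↦ (⟨x, Y x⟩ : TangentBundle (𝓡 4) N)) (p : N)
    (hY0 : Y p = 0) (hU : IsOpen (indexDomain (J.fieldSection Y) p))
    {Lp : EuclideanSpace ℝ (Fin 4) →L[ℝ] EuclideanSpace ℝ (Fin 4)}
    (hLp : HasFDerivAt (Riemannian.vectorRep (𝓡 4) p Y) Lp (extChartAt (𝓡 4) p p))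
    (hdet : LinearMap.det (Lp : EuclideanSpace ℝ (Fin 4) →ₗ[ℝ] EuclideanSpace ℝ (Fin 4)) ≠ 0) :
    J.vectorFieldIndex hY half_dim_four_pos two_mul_half_dim_four
        (homologicalOrientationOfSmooth (J.smoothOrientationOfPositiveTopForm v hv hJv)) p =
      frameSign Lf *
        ((if 0 < LinearMap.det (Lp : EuclideanSpace ℝ (Fin 4) →ₗ[ℝ] EuclideanSpace ℝ (Fin 4)) then 1 else -1) *
          indexUnitFour J Lf (μE 4)) := by
  classical
  set o := J.smoothOrientationOfPositiveTopForm v hv hJv with hodef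
  set E := J.complexTangentBundle with hEdef
  set s := J.fieldSection Y with hsdef
  set hs := J.continuous_fieldSection hY
  set c : OpenPartialHomeomorph N (EuclideanSpace ℝ (Fin 4)) := chartAt (EuclideanSpace ℝ (Fin 4)) p with hcdef
  have hpc : p ∈ c.source := mem_chart_source (EuclideanSpace ℝ (Fin 4)) p
  -- the orientation at `p` is the chart transport of the reference orientation `μR o p`
  have hμ : (homologicalOrientationOfSmooth o).localClass p =
      (chartTransport c c.open_source subset_rfl hpc 4).symm ((μR o p).localClass (c p)) := rfl
  -- the zero
  have hsp : s p = 0 := by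
    change J.modelIsoAt p (Y p) = _
    rw [hY0]
    exact map_zero _
  -- the derivative of the local representative: `Λ_p ∘ L_p`
  have hder : HasFDerivAt (E.localRepK s p c Lf)
      ((frameMap J Lf p : EuclideanSpace ℝ (Fin 4) →L[ℝ] EuclideanSpace ℝ (Fin 4)).comp Lp) (c p) := by
    have h1 := J.hasFDerivAt_localTriv_fieldSection p hY0 hLp
    have h2 := ((Lf.symm : (Fin (finrank ℝ (EuclideanSpace ℝ (Fin 4)) / 2) → ℂ) →L[ℝ] EuclideanSpace ℝ (Fin 4))).hasFDerivAt.comp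
      (extChartAt (𝓡 4) p p) h1
    refine (h2.congr_fderiv ?_).congr_of_eventuallyEq (Eventually.of_forall fun x ↦ rfl)
    ext w
    rfl
  have hcomp : (((frameMap J Lf p : EuclideanSpace ℝ (Fin 4) →L[ℝ] EuclideanSpace ℝ (Fin 4)).comp Lp :
      EuclideanSpace ℝ (Fin 4) →L[ℝ] EuclideanSpace ℝ (Fin 4)) : EuclideanSpace ℝ (Fin 4) →ₗ[ℝ] EuclideanSpace ℝ (Fin 4)) =
      ((frameMap J Lf p : EuclideanSpace ℝ (Fin 4) →L[ℝ] EuclideanSpace ℝ (Fin 4)) :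
        EuclideanSpace ℝ (Fin 4) →ₗ[ℝ] EuclideanSpace ℝ (Fin 4)).comp (Lp : EuclideanSpace ℝ (Fin 4) →ₗ[ℝ] EuclideanSpace ℝ (Fin 4)) := rfl
  have hΛ0 : LinearMap.det ((frameMap J Lf p : EuclideanSpace ℝ (Fin 4) →L[ℝ] EuclideanSpace ℝ (Fin 4)) :
      EuclideanSpace ℝ (Fin 4) →ₗ[ℝ] EuclideanSpace ℝ (Fin 4)) ≠ 0 :=
    (frameMap J Lf p).toLinearEquiv.isUnit_det'.ne_zero
  have hA : LinearMap.det ((((frameMap J Lf p : EuclideanSpace ℝ (Fin 4) →L[ℝ] EuclideanSpace ℝ (Fin 4)).comp Lp :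
      EuclideanSpace ℝ (Fin 4) →L[ℝ] EuclideanSpace ℝ (Fin 4)) : EuclideanSpace ℝ (Fin 4) →ₗ[ℝ] EuclideanSpace ℝ (Fin 4))) ≠ 0 := by
    rw [hcomp, LinearMap.det_comp]
    exact mul_ne_zero hΛ0 hdet
  have key := E.localIndex_eq_sign_det_mul_indexUnitK s hs (J.rank_complexTangentBundle_pos half_dim_four_pos)
    (J.two_mul_rank_complexTangentBundle two_mul_half_dim_four) (homologicalOrientationOfSmooth o) p hsp hU (μR o p)
    c hpc hμ Lf hder hA
  change E.localIndex s hs ℤ _ _ (homologicalOrientationOfSmooth o) p = _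
  rw [key, hcomp, LinearMap.det_comp, frameSign]
  exact sign_mul_indexUnitK_μR J.complexTangentBundle.F rfl (J.rank_complexTangentBundle_pos half_dim_four_pos)
    (J.two_mul_rank_complexTangentBundle two_mul_half_dim_four) Lf o p
    (det_frameMap_pos_iff_orientation J Lf hv hJv p) hΛ0 hdet

end LocalIndex

end Literature.Geometry.Symplectic

end
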